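import Summits.BirchSwinnertonDyer.BirchSwinnertonDyer.Theorems.ManinLocalTwoThreeStevensCurveRational
import Summits.BirchSwinnertonDyer.BirchSwinnertonDyer.Theorems.ManinLocalTwoThreeStevensCurvePresentation
import Summits.BirchSwinnertonDyer.BirchSwinnertonDyer.Theorems.ManinLocalTwoThreeFlatGamma1Datum
import Literature.NumberTheory.EllipticCurves.LatticeInclusionIsogenyComplexPointsProofs
import Literature.NumberTheory.EllipticCurves.ModularCurveManinSemistableBridgeProofs
import Literature.NumberTheory.EllipticCurves.EichlerShimuraConstructionKernelProofs
import Literature.NumberTheory.EllipticCurves.ModularParametrizationProofs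
import Literature.NumberTheory.EllipticCurves.ModularCurveManinConstantProofs
import Literature.NumberTheory.EllipticCurves.ManinConstantGamma1Gamma0Comparison
import HarnessLib

/-!
# The Stevens curve `ℂ/Λ₁(f)` is an elliptic curve over `ℚ`, `ℚ`-isogenous to the strong Weil curve, with an OPTIMAL
# `X₁(N)`-datum of Manin constant `1` — CES♭, fact-free
(route `ManinLocalTwoThree`, cruxes C2 stmt-BirchSwinnertonDyer-22967 / C3 stmt-BirchSwinnertonDyer-22968, rung stmt-…-22445; cell bsd-f2-manin,
prover p3 gen 21; CES-discharge programme, stage 1 step (D♭))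

The cell's conditional theorems (KDR½, E-es-187/188, the Derickx–Orlić cyclicity rows, the Abbes–Ullmo / Česnavičius corollaries, the rung
`maninConstantOne_of_fourPrintedFacts`) consume the printed fact CES = `exists_optimal_gamma1ParametrizationData` (Conrad–Edixhoven–Stein 2003
§6.1 / Stevens 1989 §2: in the class of an `X₀(N)`-optimal curve there is a globally minimal `W₁` with an OPTIMAL `X₁(N)`-datum).  What those
proofs USE of CES is only: an elliptic `W₁/ℚ` with an optimal `X₁(N)`-datum `D₁` (`Λ_{W₁} = c₁Λ₁(f)`), `ℚ`-isogenous to `W₀` — the optimality feeds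
T-es-75 (`kummerDiamondReciprocity`), the isogeny carries the Kummer values back to `W₀`; global minimality of `W₁` and the integrality of the
Manin constant of the MINIMAL model are never used.  THIS FILE PROVES THAT WEAKER STATEMENT (CES♭) UNCONDITIONALLY:

* `ratCast_g₂_g₃_periodLatticeGamma1` — **`g₂(Λ₁(f)), g₃(Λ₁(f)) ∈ ℚ`** for the newform of any `X₀(N)`-datum (siblings (A1)–(A3):
  `exists_gamma1_presentation_periodLatticeGamma1` + `ratCast_g₂_g₃_of_gamma1_presentation`, Aut(ℂ)-descent with Deligne–Serre (2.7.2)_holds);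
* `exists_periodPair_periodLattice_of_latticeClause` — `Λ₀(f) = c₀⁻¹Λ_{W₀}` is a lattice for a lattice-optimal datum;
* `exists_stevensCurve` — **for every elliptic `W₀/ℚ` with a lattice-optimal `X₀(N)`-datum `D₀` (`Λ_{W₀} = c₀Λ₀(f)`) there are an elliptic curve
  `W₁/ℚ` (the short model `y² = x³ − g₂/4·x − g₃/4` of `ℂ/Λ₁(f)`) and `D₁ : Gamma1ParametrizationData W₁ N` with `D₁.f = D₀.f`, `D₁.c = 1`,
  `D₁.IsOptimal`, `Λ(D₁.L) = Λ₁(f)`, and a `ℚ`-isogeny `ψ : W₁ → W₀` with `ψ_ℂ(π₁ z) = π₀(c₀ z)`** (`exists_isogeny_baseChange_apply_eq_of_forall_mul_mem_lattice`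
  on `c₀Λ₁ ⊆ c₀Λ₀ ⊆ Λ_{W₀}`; `IsNewformOf.of_isIsogenous`; the degree by p2's `FlatGamma1Datum.exists_gamma1_modularDegree`);
* `exists_optimal_gamma1ParametrizationData_flat` — **CES♭**: the body of `exists_optimal_gamma1ParametrizationData` without «`W₁` globally
  minimal», for every elliptic `W₀` (no minimality needed on `W₀` either).

What is NOT here (stage 3 of the programme): `c₁ ∈ ℤ` for the MINIMAL model of `W₁` (Conrad–Edixhoven–Stein Lemma 6.1.6), i.e. CES verbatim — it
needs the `Γ₁(N)`-port of the tree's Edixhoven local programme (`exists_formalParam_of_neronLattice_eq_smul_periodLattice`).  No named fact is used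
or introduced; standard axioms.  BSD is not proved by this file; Manin's conjecture, C2 and C3 are not proved by this file.
[cite: Stevens1989, §2 (pp. 79, 88)] [cite: ConradEdixhovenStein2003, §6.1 (pp. 380–381)] [cite: SilvermanAEC2009, Thm. VI.4.1, Prop. VI.3.6]
[cite: Knapp1993, Thm. 11.74 (d)] [cite: DeligneSerreASENS1974, Prop. 2.7 (2.7.2)]
-/

set_option autoImplicit false
-- lint-debt: the directory name repeats the summit name (sibling precedent `ManinLocalTwoThreeCDivisionGamma1Core.lean`)
set_option linter.dupNamespace false

noncomputable section

open Complex Filter Topology Set Function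
open UpperHalfPlane hiding I
open scoped Real Topology Manifold MatrixGroups PeriodPair ModularForm
open CongruenceSubgroup
open Literature.NumberTheory.EllipticCurves Literature.NumberTheory.EllipticCurves.ModularForms

namespace Summit.BirchSwinnertonDyer.BirchSwinnertonDyer.Theorems.ManinLocalTwoThree.StevensCurve

variable {N : ℕ} [NeZero N]

/-! ### Rational invariants of `Λ₁(f)` (assembly of (A1)–(A3)) -/

/-- **`g₂(Λ₁(f)), g₃(Λ₁(f)) ∈ ℚ`**: for a nonzero `f ∈ S₂(Γ₀(N))` with rational Fourier coefficients and a period pair `L₁` with `Λ(L₁) = Λ₁(f)`,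
the Weierstrass invariants of `L₁` are rational (`exists_gamma1_presentation_periodLatticeGamma1` + `ratCast_g₂_g₃_of_gamma1_presentation`).
[cite: Stevens1989, §2] [cite: Knapp1993, Thm. 11.74 (d)] [cite: DeligneSerreASENS1974, Prop. 2.7 (2.7.2)] -/
theorem ratCast_g₂_g₃_periodLatticeGamma1 (f : CuspForm (Gamma0 N) 2) (hf : f ≠ 0)
    (hrat : ∀ n, ∃ q : ℚ, (q : ℂ) = cuspCoeff f n) (L₁ : PeriodPair)
    (hL₁ : ∀ x, x ∈ L₁.lattice ↔ x ∈ periodLatticeGamma1 f) :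
    (∃ q : ℚ, (q : ℂ) = L₁.g₂) ∧ (∃ q : ℚ, (q : ℂ) = L₁.g₃) :=
  ratCast_g₂_g₃_of_gamma1_presentation f hf hrat L₁ hL₁ (exists_gamma1_presentation_periodLatticeGamma1 f hf L₁ hL₁)

/-! ### `Λ₀(f)` and `Λ₁(f)` of a lattice-optimal datum -/

/-- For a lattice-optimal `X₀(N)`-datum (`Λ_{W₀} = c₀Λ₀(f)`), `Λ₀(f) = c₀⁻¹Λ_{W₀}` is the lattice of the period pair `c₀⁻¹·D₀.L`. [folklore] -/
theorem exists_periodPair_periodLattice_of_latticeClause {W₀ : WeierstrassCurve ℚ} [W₀.IsElliptic] (D₀ : ModularParametrizationData W₀ N)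
    (hopt : ∀ z ∈ D₀.L.lattice, ∃ w ∈ periodLattice D₀.f, z = D₀.c * w) :
    ∃ L₀ : PeriodPair, ∀ x, x ∈ L₀.lattice ↔ x ∈ periodLattice D₀.f := by
  have hc₀ : D₀.c ≠ 0 := D₀.maninConstant_ne_zero_holds
  have hc₀C : (D₀.c : ℂ) ≠ 0 := by exact_mod_cast hc₀
  refine ⟨D₀.L.mulLeft ((D₀.c : ℂ)⁻¹) (inv_ne_zero hc₀C), fun x ↦ ?_⟩
  rw [PeriodPair.mem_mulLeft_lattice, inv_inv]
  constructor
  · intro hx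
    obtain ⟨w, hw, hxw⟩ := hopt _ hx
    rwa [mul_left_cancel₀ hc₀C hxw]
  · exact D₀.smul_periodLattice_le x

/-- For a lattice-optimal `X₀(N)`-datum, the Stevens lattice `Λ₁(f)` is the lattice of a period pair. [cite: Stevens1989, §2] -/
theorem exists_periodPair_periodLatticeGamma1_of_latticeClause {W₀ : WeierstrassCurve ℚ} [W₀.IsElliptic]
    (D₀ : ModularParametrizationData W₀ N) (hopt : ∀ z ∈ D₀.L.lattice, ∃ w ∈ periodLattice D₀.f, z = D₀.c * w) :
    ∃ L₁ : PeriodPair, ∀ x, x ∈ L₁.lattice ↔ x ∈ periodLatticeGamma1 D₀.f := by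
  obtain ⟨L₀, hL₀⟩ := exists_periodPair_periodLattice_of_latticeClause D₀ hopt
  exact exists_periodPair_periodLatticeGamma1 D₀.f L₀ hL₀

/-! ### The Stevens curve over `ℚ` with its optimal `X₁(N)`-datum -/

section Isogeny

variable [Algebra (AlgebraicClosure ℚ) ℂ] [IsScalarTower ℚ (AlgebraicClosure ℚ) ℂ]

/-- **The Stevens curve over `ℚ`, with its optimal `X₁(N)`-datum of Manin constant `1` and its `ℚ`-isogeny to `W₀`.**  Let `W₀/ℚ` be elliptic with
a lattice-optimal `X₀(N)`-datum `D₀` (`Λ_{W₀} = c₀Λ₀(f)`).  Then there are an elliptic curve `W₁/ℚ` and `D₁ : Gamma1ParametrizationData W₁ N` with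
the same newform, `D₁.c = 1`, `D₁.IsOptimal`, `Λ(D₁.L) = Λ₁(f)`, together with a `ℚ`-isogeny `ψ : W₁ → W₀` satisfying `ψ_ℂ(π₁ z) = π₀(c₀·z)` for all
`z ∈ ℂ` (`π₁ = D₁.uniformize`, `π₀ = D₀.uniformize`).  `W₁` is the short model `y² = x³ − g₂(Λ₁)/4·x − g₃(Λ₁)/4`, an elliptic curve over `ℚ` by
`ratCast_g₂_g₃_periodLatticeGamma1`; the isogeny is Silverman VI.4.1 on `c₀Λ₁(f) ⊆ c₀Λ₀(f) ⊆ Λ_{W₀}`; `a_n(W₁) = a_n(W₀)` along it; the degree of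
`X₁(N) → W₁` by `FlatGamma1Datum.exists_gamma1_modularDegree`.  (Analytic form of Stevens 1989 §2 / Conrad–Edixhoven–Stein §6.1 up to the Manin
constant of the minimal model.) [cite: Stevens1989, §2] [cite: ConradEdixhovenStein2003, §6.1] [cite: SilvermanAEC2009, Thm. VI.4.1] -/
theorem exists_stevensCurve {W₀ : WeierstrassCurve ℚ} [W₀.IsElliptic] (D₀ : ModularParametrizationData W₀ N)
    (hopt : ∀ z ∈ D₀.L.lattice, ∃ w ∈ periodLattice D₀.f, z = D₀.c * w) :
    ∃ (W₁ : WeierstrassCurve ℚ) (_ : W₁.IsElliptic) (D₁ : Gamma1ParametrizationData W₁ N),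
      D₁.f = D₀.f ∧ D₁.c = 1 ∧ D₁.IsOptimal ∧ (∀ x, x ∈ D₁.L.lattice ↔ x ∈ periodLatticeGamma1 D₀.f) ∧
      ∃ ψ : WeierstrassCurve.Isogeny W₁ W₀, ∀ z : ℂ, ψ.baseChange (M := ℂ) (D₁.uniformize z) = D₀.uniformize ((D₀.c : ℂ) * z) := by
  classical
  have hf : D₀.f ≠ 0 := D₀.isNewformOf.1.ne_zero
  have hc₀ : D₀.c ≠ 0 := D₀.maninConstant_ne_zero_holds
  have hrat : ∀ n, ∃ q : ℚ, (q : ℂ) = cuspCoeff D₀.f n := fun n ↦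
    ⟨(W₀.LFunction n : ℚ), by rw [D₀.isNewformOf.2 n, Rat.cast_intCast]⟩
  -- `Λ₁(f)` as a period pair with rational invariants; the short model `E`
  obtain ⟨L₁, hL₁⟩ := exists_periodPair_periodLatticeGamma1_of_latticeClause D₀ hopt
  obtain ⟨⟨q₂, hq₂⟩, ⟨q₃, hq₃⟩⟩ := ratCast_g₂_g₃_periodLatticeGamma1 D₀.f hf hrat L₁ hL₁
  set a₄ : ℚ := -q₂ / 4 with ha₄
  set a₆ : ℚ := -q₃ / 4 with ha₆
  have h₂ : L₁.g₂ = -4 * (a₄ : ℂ) := by rw [← hq₂, ha₄]; push_cast; ring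
  have h₃ : L₁.g₃ = -4 * (a₆ : ℂ) := by rw [← hq₃, ha₆]; push_cast; ring
  set E : WeierstrassCurve ℚ := { a₁ := 0, a₂ := 0, a₃ := 0, a₄ := a₄, a₆ := a₆ } with hE
  haveI hEe : E.IsElliptic := isElliptic_shortModel h₂ h₃
  have hEL : IsNeronLatticeOf (E.baseChange ℂ) L₁ := isNeronLatticeOf_shortModel h₂ h₃
  haveI : (E.baseChange ℂ).IsElliptic := by rw [WeierstrassCurve.baseChange]; infer_instance
  obtain ⟨u, hker, hsurj, hspec⟩ := IsNeronLatticeOf.exists_uniformize_holds hEL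
  -- the `ℚ`-isogeny `E → W₀` attached to `c₀Λ₁(f) ⊆ Λ_{W₀}`
  have hc₀Q : (D₀.c : ℚ) ≠ 0 := by exact_mod_cast hc₀
  have hle : ∀ z ∈ L₁.lattice, ((D₀.c : ℚ) : ℂ) * z ∈ D₀.L.lattice := fun z hz ↦ by
    rw [Rat.cast_intCast]
    exact D₀.smul_periodLattice_le z (periodLatticeGamma1_le_periodLattice D₀.f ((hL₁ z).mp hz))
  obtain ⟨ψ, hψ, -, -⟩ := exists_isogeny_baseChange_apply_eq_of_forall_mul_mem_lattice hEL.1 hEL.2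
    D₀.isNeronLattice.1 D₀.isNeronLattice.2 hker hsurj hspec D₀.ker_uniformize D₀.uniformize_spec hc₀Q hle
  have hiso : WeierstrassCurve.IsIsogenous E W₀ := ⟨ψ⟩
  have hnf : IsNewformOf E D₀.f := D₀.isNewformOf.of_isIsogenous hiso
  -- the degree of the `X₁(N)`-parametrisation `Γ₁(N)τ ↦ u(ℰ_f(τ))`
  have h1 : ∀ z ∈ periodLatticeGamma1 D₀.f, (1 : ℂ) * z ∈ L₁.lattice := fun z hz ↦ by
    rw [one_mul]; exact (hL₁ z).mpr hz
  obtain ⟨d, hd, hfin⟩ := FlatGamma1Datum.exists_gamma1_modularDegree hf (L := L₁) one_ne_zero h1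
  have hker' : L₁.lattice.toAddSubgroup = u.ker :=
    SetLike.coe_injective (by rw [Submodule.coe_toAddSubgroup, hker])
  let e : ℂ ⧸ L₁.lattice.toAddSubgroup ≃+ (E.baseChange ℂ).toAffine.Point :=
    QuotientAddGroup.liftEquiv L₁.lattice.toAddSubgroup hsurj hker'
  have he : ∀ x : ℂ, e.toEquiv (x : ℂ ⧸ L₁.lattice.toAddSubgroup) = u x := fun _ ↦ rfl
  have key := (FlatGamma1Datum.finite_setOf_natCard_gamma1FiberOrbits_ne_iff e.toEquiv
    (fun τ : ℍ ↦ (((1 : ℂ) * eichlerIntegral D₀.f τ : ℂ) : ℂ ⧸ L₁.lattice.toAddSubgroup)) d).mpr hfin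
  simp only [he] at key
  have key' : {P : (E.baseChange ℂ).toAffine.Point |
      Nat.card {y : Y1 N // ∃ τ : ℍ, Y1.mk N τ = y ∧ u ((((1 : ℤ) : ℂ)) * eichlerIntegral D₀.f τ) = P} ≠ d}.Finite := by
    rw [Int.cast_one]
    exact key
  refine ⟨E, hEe,
    { f := D₀.f
      isNewformOf := hnf
      L := L₁
      isNeronLattice := hEL
      uniformize := u
      ker_uniformize := hker
      uniformize_surjective := hsurj
      uniformize_spec := hspec
      c := 1
      smul_periodLatticeGamma1_le := fun z hz ↦ by rw [Int.cast_one, one_mul]; exact (hL₁ z).mpr hz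
      deg := d
      deg_pos := hd
      deg_spec := key' }, rfl, rfl, ?_, fun x ↦ hL₁ x, ψ, fun z ↦ ?_⟩
  · -- optimality: `Λ(L₁) = 1·Λ₁(f)`
    intro z hz
    exact ⟨z, (hL₁ z).mp hz, by push_cast; ring⟩
  · -- `ψ_ℂ(π₁ z) = π₀(c₀ z)`
    have h := hψ z
    rw [Rat.cast_intCast] at h
    exact h

end Isogeny

/-- **CES♭ — Stevens' `X₁(N)`-optimal datum in the isogeny class, fact-free (without global minimality of `W₁`).**  For every elliptic `W₀/ℚ`
with a lattice-optimal `X₀(N)`-datum there are an elliptic `W₁/ℚ`, `ℚ`-isogenous to `W₀`, and an OPTIMAL `X₁(N)`-datum `D₁` of `W₁`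
(`Λ_{W₁} = c₁Λ₁(f)`, here with `c₁ = 1`).  Verbatim the body of the printed fact `exists_optimal_gamma1ParametrizationData` except that `W₁` is
not asserted globally minimal (and `W₀` need not be).  [cite: Stevens1989, §2 (Prop. (1.4), (2.8))] [cite: ConradEdixhovenStein2003, §6.1] -/
theorem exists_optimal_gamma1ParametrizationData_flat {W₀ : WeierstrassCurve ℚ} [W₀.IsElliptic] (D₀ : ModularParametrizationData W₀ N)
    (hopt : ∀ z ∈ D₀.L.lattice, ∃ w ∈ periodLattice D₀.f, z = D₀.c * w) :
    ∃ (W₁ : WeierstrassCurve ℚ) (_ : W₁.IsElliptic) (D₁ : Gamma1ParametrizationData W₁ N), WeierstrassCurve.IsIsogenous W₁ W₀ ∧ D₁.IsOptimal := by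
  haveI : Algebra.IsAlgebraic ℚ (AlgebraicClosure ℚ) := AlgebraicClosure.isAlgebraic ℚ
  haveI : IsAlgClosure ℚ (AlgebraicClosure ℚ) := AlgebraicClosure.instIsAlgClosure ℚ
  letI : Algebra (AlgebraicClosure ℚ) ℂ := (IsAlgClosed.lift : AlgebraicClosure ℚ →ₐ[ℚ] ℂ).toRingHom.toAlgebra
  haveI : IsScalarTower ℚ (AlgebraicClosure ℚ) ℂ := IsScalarTower.of_algebraMap_eq' (Subsingleton.elim _ _)
  obtain ⟨W₁, hW₁, D₁, -, -, hopt₁, -, ψ, -⟩ := exists_stevensCurve D₀ hopt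
  exact ⟨W₁, hW₁, D₁, ⟨ψ⟩, hopt₁⟩

/-- **The Stevens datum with its newform and lattice identified** (instance-free corollary of `exists_stevensCurve`): `D₁.f = D₀.f`, `D₁.c = 1`,
`D₁.IsOptimal`, `Λ(D₁.L) = Λ₁(f)`, `W₁ ∼ W₀`. [cite: Stevens1989, §2] [cite: ConradEdixhovenStein2003, §6.1] -/
theorem exists_optimal_gamma1ParametrizationData_one {W₀ : WeierstrassCurve ℚ} [W₀.IsElliptic] (D₀ : ModularParametrizationData W₀ N)
    (hopt : ∀ z ∈ D₀.L.lattice, ∃ w ∈ periodLattice D₀.f, z = D₀.c * w) :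
    ∃ (W₁ : WeierstrassCurve ℚ) (_ : W₁.IsElliptic) (D₁ : Gamma1ParametrizationData W₁ N),
      D₁.f = D₀.f ∧ D₁.c = 1 ∧ D₁.IsOptimal ∧ (∀ x, x ∈ D₁.L.lattice ↔ x ∈ periodLatticeGamma1 D₀.f) ∧ WeierstrassCurve.IsIsogenous W₁ W₀ := by
  haveI : Algebra.IsAlgebraic ℚ (AlgebraicClosure ℚ) := AlgebraicClosure.isAlgebraic ℚ
  haveI : IsAlgClosure ℚ (AlgebraicClosure ℚ) := AlgebraicClosure.instIsAlgClosure ℚ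
  letI : Algebra (AlgebraicClosure ℚ) ℂ := (IsAlgClosed.lift : AlgebraicClosure ℚ →ₐ[ℚ] ℂ).toRingHom.toAlgebra
  haveI : IsScalarTower ℚ (AlgebraicClosure ℚ) ℂ := IsScalarTower.of_algebraMap_eq' (Subsingleton.elim _ _)
  obtain ⟨W₁, hW₁, D₁, hf, hc, hopt₁, hL, ψ, -⟩ := exists_stevensCurve D₀ hopt
  exact ⟨W₁, hW₁, D₁, hf, hc, hopt₁, hL, ⟨ψ⟩⟩

end Summit.BirchSwinnertonDyer.BirchSwinnertonDyer.Theorems.ManinLocalTwoThree.StevensCurve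

end
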